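import Mathlib
import Summits.ResolutionOfSingularities.ResolutionOfSingularities.Theorems.SyzygyFlatteningDefs
import Summits.ResolutionOfSingularities.ResolutionOfSingularities.Theorems.SyzygyFlatteningHigherRankTerminationTowerStageBasic
import Summits.ResolutionOfSingularities.ResolutionOfSingularities.Theorems.SyzygyFlatteningHigherRankTerminationLocAt
import Summits.ResolutionOfSingularities.ResolutionOfSingularities.Theorems.SyzygyFlatteningHigherRankTerminationTowerLocalisation
import Summits.ResolutionOfSingularities.ResolutionOfSingularities.Theorems.SyzygyFlatteningHigherRankTerminationBaseChangeIsLocalization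
import Summits.ResolutionOfSingularities.ResolutionOfSingularities.Theorems.SyzygyFlatteningHigherRankTerminationRegularLocusPolynomial
import Summits.ResolutionOfSingularities.ResolutionOfSingularities.Theorems.SyzygyFlatteningHigherRankTerminationBaseChangedDatum
import Summits.ResolutionOfSingularities.ResolutionOfSingularities.Theorems.SyzygyFlatteningHigherRankTerminationSingIdealBaseChange
import Summits.ResolutionOfSingularities.ResolutionOfSingularities.Theorems.SyzygyFlatteningHigherRankTerminationNrmBaseChange
import Summits.ResolutionOfSingularities.ResolutionOfSingularities.Theorems.SyzygyFlatteningHigherRankTerminationBaseChangeModel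
import Summits.ResolutionOfSingularities.ResolutionOfSingularities.Theorems.SyzygyFlatteningHigherRankTerminationRegularityDescends
import HarnessLib

/-!
# The syzygy-flattening tower commutes with the base change `(k, K) ↦ (k(X), K(X))`

Crux `HigherRankTermination` (stmt-ResolutionOfSingularities-17045), line `birth`, base-change line of
`stub_posDimRankOne` (lead c2): the GLUE assembling the landed wave-1/wave-2 stubs into

* `tower_baseChange` — for valuation rings `O` of `K` and `O'` of `K(X)` with `O ⊆ O'` along
  `K → K(X)`, a ground field `k ⊆ O` and its extension `k' = k(X) ⊆ O'` with the SAME syzygy index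
  (`tr.deg_{k(X)} K(X) = tr.deg_k K`), and a finitely generated model `A ⊆ O` with `Frac A = K`:
  the tower along `O'` started at the base-changed model `k(X)·A` is, stage by stage, the base
  change of the tower along `O` localised at the centre of `O'`:
  `tower O' (k(X)·A) m = locAt O' (k(X)·(tower O A m))`.
  Induction on `m`, both sides of stage `m + 1` being `locAt O' (nrm (k(X)·T[N/det x]))` for ONE
  `O`-minimal chart datum of `T = tower O A m` (`locAt_step_eq` over `k` and over `k'`; the datum
  is base-changed by `stub_baseChangedDatum` — flat base change, `J` extends by
  `stub_singIdeal_baseChange`, minors are spanned by the old ones so `x` stays `O'`-minimal — and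
  then localised by `stub_localizedDatum`; normalisation commutes with the base change,
  `stub_nrm_baseChange`, and with localisation, `stub_nrm_locAt`).
* `towerTerminates_of_baseChange` — if moreover `O = O' ∩ K`, termination of the base-changed tower
  gives termination of the original one: a regular stage `locAt O' (k(X)·T_m)` forces `T_m` regular
  (`stub_regularity_descends`: the map is flat and local, Matsumura 23.7 (i)).

References: Matsumura, *Commutative Ring Theory*, Thm. 23.7 (i) and §19 (after Lemma 4);
Novacoski–Spivakovsky 2014, Lemma 2.5 (the shape: the operator commutes with a flat change of the
local ring); Kuhlmann 2010, Lemma 2.5 (the base change used by the line).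
-/

noncomputable section

-- single-problem summit: the doubled namespace component `ResolutionOfSingularities` is forced
set_option linter.dupNamespace false

namespace Summit.ResolutionOfSingularities.ResolutionOfSingularities.Theorems.SyzygyFlattening

open Literature.AlgebraicGeometry.Resolution

/-! ## The base change `B ↦ k(X)·B` of models: elementary facts -/

section basics

variable {k K : Type} [Field k] [Field K] [Algebra k K]
variable {k' : Type} [Field k'] [Algebra k k'] [Algebra k' (RatFunc K)] [IsScalarTower k k' (RatFunc K)]

/-- The scalars of `k` are scalars of `k'` inside `K(X)`. [folklore] -/
theorem bc_algebraMap_compat (c : k) :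
    algebraMap K (RatFunc K) (algebraMap k K c) = algebraMap k' (RatFunc K) (algebraMap k k' c) := by
  rw [← IsScalarTower.algebraMap_apply k K (RatFunc K) c,
    ← IsScalarTower.algebraMap_apply k k' (RatFunc K) c]

/-- Base change of a generated subalgebra: `k'·(k[S]) = k'[S]` inside `K(X)`. [folklore] -/
theorem bc_adjoin_eq (S : Set K) :
    Algebra.adjoin k' ((algebraMap K (RatFunc K)) '' (Algebra.adjoin k S : Set K)) =
      Algebra.adjoin k' ((algebraMap K (RatFunc K)) '' S) := by
  apply le_antisymm
  · exact Algebra.adjoin_le (baseChangeModel_image_adjoin_subset (algebraMap K (RatFunc K))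
      (algebraMap k k') bc_algebraMap_compat S)
  · exact Algebra.adjoin_mono (Set.image_mono Algebra.subset_adjoin)

omit [Algebra k k'] [IsScalarTower k k' (RatFunc K)] in
/-- Base change is monotone in the model. [folklore] -/
theorem bc_mono {B C : Subalgebra k K} (h : B ≤ C) :
    Algebra.adjoin k' ((algebraMap K (RatFunc K)) '' (B : Set K)) ≤
      Algebra.adjoin k' ((algebraMap K (RatFunc K)) '' (C : Set K)) :=
  Algebra.adjoin_mono (Set.image_mono h)

omit [Algebra k k'] [IsScalarTower k k' (RatFunc K)] in
/-- The base change of a model `B ⊆ O` lies in `O'` when `O ↦ O'` and `k' ⊆ O'`. [folklore] -/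
theorem bc_toSubring_le (O : ValuationSubring K) (O' : ValuationSubring (RatFunc K))
    (hOO' : ∀ x : K, x ∈ O → algebraMap K (RatFunc K) x ∈ O')
    (hk' : ∀ g : k', algebraMap k' (RatFunc K) g ∈ O') (B : Subalgebra k K)
    (hB : B.toSubring ≤ O.toSubring) :
    (Algebra.adjoin k' ((algebraMap K (RatFunc K)) '' (B : Set K))).toSubring ≤ O'.toSubring := by
  refine adjoin_toSubring_le_valuationSubring O' hk' ?_
  rintro _ ⟨b, hb, rfl⟩
  exact hOO' b (hB (Subalgebra.mem_toSubring.mpr hb))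

/-- **Base change commutes with localising at the centre, up to localising at the new centre**:
`locAt O' (k'·(locAt O B)) = locAt O' (k'·B)` for `B ⊆ O ↦ O'` (an `O`-unit of `B` maps to an
`O'`-unit of `k'·B`). [folklore] -/
theorem locAt_bc_locAt (O : ValuationSubring K) (O' : ValuationSubring (RatFunc K))
    (hOO' : ∀ x : K, x ∈ O → algebraMap K (RatFunc K) x ∈ O')
    (hk' : ∀ g : k', algebraMap k' (RatFunc K) g ∈ O') (B : Subalgebra k K)
    (hB : B.toSubring ≤ O.toSubring) :
    locAt O' (Algebra.adjoin k' ((algebraMap K (RatFunc K)) '' (locAt O B : Set K))) =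
      locAt O' (Algebra.adjoin k' ((algebraMap K (RatFunc K)) '' (B : Set K))) := by
  have hE : (Algebra.adjoin k' ((algebraMap K (RatFunc K)) '' (B : Set K))).toSubring ≤
      O'.toSubring := bc_toSubring_le O O' hOO' hk' B hB
  apply le_antisymm
  · rw [← locAt_locAt O' _ hE]
    refine locAt_mono O' (Algebra.adjoin_le ?_)
    refine (baseChangeModel_image_adjoin_subset (algebraMap K (RatFunc K)) (algebraMap k k')
      bc_algebraMap_compat _).trans ?_
    refine Algebra.adjoin_le ?_
    rintro _ ⟨_, ⟨a, ha, s, hs, hsO, rfl⟩, rfl⟩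
    rw [map_mul, map_inv₀]
    exact mul_inv_mem_locAt O' _ (Algebra.subset_adjoin ⟨a, ha, rfl⟩)
      (Algebra.subset_adjoin ⟨s, hs, rfl⟩) (by rw [← map_inv₀]; exact hOO' _ hsO)
  · exact locAt_mono O' (bc_mono (self_le_locAt O B))

omit [Algebra k k'] [IsScalarTower k k' (RatFunc K)] in
/-- The inclusion `ψ : B → k'·B` along `K → K(X)` (as an existential, `D-0009`). [folklore] -/
theorem exists_bcHom (B : Subalgebra k K) :
    ∃ ψ : ↥B →+* ↥(Algebra.adjoin k' ((algebraMap K (RatFunc K)) '' (B : Set K))),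
      ∀ b : ↥B, (ψ b : RatFunc K) = algebraMap K (RatFunc K) b := by
  refine ⟨((algebraMap K (RatFunc K)).comp B.val.toRingHom).codRestrict
    (Algebra.adjoin k' ((algebraMap K (RatFunc K)) '' (B : Set K))).toSubring
    (fun b => Algebra.subset_adjoin ⟨b, b.2, rfl⟩), fun b => rfl⟩

omit [Algebra k k'] [IsScalarTower k k' (RatFunc K)] in
/-- `X` as an element of `k'·B` (it lies in `k' = k(X)`). [folklore] -/
theorem exists_bcX
    (hrange : Set.range (algebraMap k' (RatFunc K)) =
      ((IntermediateField.adjoin k {(RatFunc.X : RatFunc K)} : IntermediateField k (RatFunc K)) :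
        Set (RatFunc K))) (B : Subalgebra k K) :
    ∃ XE : ↥(Algebra.adjoin k' ((algebraMap K (RatFunc K)) '' (B : Set K))),
      (XE : RatFunc K) = RatFunc.X := by
  have h : (RatFunc.X : RatFunc K) ∈ Set.range (algebraMap k' (RatFunc K)) := by
    rw [hrange]
    exact IntermediateField.mem_adjoin_simple_self k (RatFunc.X : RatFunc K)
  obtain ⟨x, hx⟩ := h
  exact ⟨⟨RatFunc.X, hx ▸ Subalgebra.algebraMap_mem _ x⟩, rfl⟩

end basics

/-! ## The tower commutes with the base change -/

section tower

variable {k K : Type} [Field k] [Field K] [Algebra k K]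
variable {k' : Type} [Field k'] [Algebra k k'] [Algebra k' (RatFunc K)] [IsScalarTower k k' (RatFunc K)]

/-- **One stage, both sides in canonical form.** For a stage `T ⊆ O` of the `O`-tower (noetherian,
essentially of finite type, `Frac T = K`) whose base change satisfies the induction hypothesis,
`step O' (locAt O' (k'·T))` and `locAt O' (k'·(step O T))` coincide. [cite: Matsumura1987, §19 (after Lemma 4)] -/
theorem step_baseChange
    (hrange : Set.range (algebraMap k' (RatFunc K)) =
      ((IntermediateField.adjoin k {(RatFunc.X : RatFunc K)} : IntermediateField k (RatFunc K)) :
        Set (RatFunc K)))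
    (O : ValuationSubring K) (O' : ValuationSubring (RatFunc K))
    (hOO' : ∀ x : K, x ∈ O → algebraMap K (RatFunc K) x ∈ O')
    (hk : ∀ c : k, algebraMap k K c ∈ O) (hk' : ∀ g : k', algebraMap k' (RatFunc K) g ∈ O')
    (hidx : syzygyIndex k' (RatFunc K) = syzygyIndex k K)
    (T : Subalgebra k K) (hT : T.toSubring ≤ O.toSubring) (hFracT : IsFractionRing ↥T K)
    (hEFT : Algebra.EssFiniteType k ↥T) :
    step O' (locAt O' (Algebra.adjoin k' ((algebraMap K (RatFunc K)) '' (T : Set K)))) =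
      locAt O' (Algebra.adjoin k' ((algebraMap K (RatFunc K)) '' (step O T : Set K))) := by
  haveI : IsNoetherianRing ↥T := by
    haveI := hEFT
    exact Algebra.EssFiniteType.isNoetherianRing k ↥T
  -- the base-changed stage `E = k'·T`, its inclusion `ψ`, its `X`, its structure
  set E := Algebra.adjoin k' ((algebraMap K (RatFunc K)) '' (T : Set K)) with hEdef
  have hET : E.toSubring ≤ O'.toSubring := bc_toSubring_le O O' hOO' hk' T hT
  obtain ⟨ψ, hψ⟩ := exists_bcHom (k' := k') T
  obtain ⟨XE, hXE⟩ := exists_bcX hrange T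
  have hloc := stub_baseChange_isLocalization k K k' hrange T E rfl ψ XE hψ hXE
  have hmodel := stub_baseChange_model k K k' hrange T E rfl
  have hFracE : IsFractionRing ↥E (RatFunc K) := hmodel.2.1 hFracT
  have hEFTE : Algebra.EssFiniteType k' ↥E := hmodel.2.2 hEFT
  have hJ : singIdeal E = (singIdeal T).map ψ :=
    stub_singIdeal_baseChange k K k' hrange T E rfl hEFT ψ XE hψ hXE hloc stub_regularLocus_polynomial
  -- an `O`-minimal datum over `T`, its base change over `E`, and its localisation over `locAt O' E`
  obtain ⟨b, d, ε, r, ι, hε, h0, hs, hι, htors, x, hx0, hmin⟩ :=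
    stub_exists_minimalDatum k K O T hT inferInstance hFracT
  obtain ⟨b₁, d₁, ε₁, r₁, ι₁, x₁, ⟨hε₁, h0₁, hs₁, hι₁, htors₁⟩, hx0₁, hmin₁, hadj₁⟩ :=
    stub_baseChangedDatum k K O O' k' hrange hOO' hk' T E rfl hT ψ XE hψ hXE hloc hJ hidx
      b d ε r ι x hε h0 hs hι htors hx0 hmin
  have hJ₂ := stub_singIdeal_locAt k' (RatFunc K) O' E hET hEFTE hFracE
  obtain ⟨b₂, d₂, ε₂, r₂, ι₂, x₂, ⟨hε₂, h0₂, hs₂, hι₂, htors₂⟩, hx0₂, hmin₂, hadj₂⟩ :=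
    stub_localizedDatum k' (RatFunc K) O' O' E hk' le_rfl hET hFracE hJ₂
      b₁ d₁ ε₁ r₁ ι₁ x₁ hε₁ h0₁ hs₁ hι₁ htors₁ hx0₁ hmin₁
  -- the k-side step in canonical form: `step O T = locAt O (nrm C)`, `C = T[ratios]`
  have hRO : {y : K | ∃ g : Fin r → ↥(LinearMap.range (d (syzygyIndex k K - 1))),
      y = Matrix.det (Matrix.of fun i j => ((ι (g i) j : ↥T) : K)) *
        (Matrix.det (Matrix.of fun i j => ((ι (x i) j : ↥T) : K)))⁻¹} ⊆ O := by
    rintro _ ⟨g, rfl⟩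
    exact hmin g
  have hCO := adjoin_ratios_le O O le_rfl T hk hT _ hRO
  have hnrmCO := nrm_toSubring_le O hk hCO
  have hTC : T ≤ Algebra.adjoin k ((T : Set K) ∪
      {y : K | ∃ g : Fin r → ↥(LinearMap.range (d (syzygyIndex k K - 1))),
        y = Matrix.det (Matrix.of fun i j => ((ι (g i) j : ↥T) : K)) *
          (Matrix.det (Matrix.of fun i j => ((ι (x i) j : ↥T) : K)))⁻¹}) :=
    fun y hy => Algebra.subset_adjoin (Or.inl hy)
  have hFracC := haveI := hFracT; isFractionRing_subalgebra_of_le T _ hTC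
  have hL : step O T = locAt O (nrm (Algebra.adjoin k ((T : Set K) ∪
      {y : K | ∃ g : Fin r → ↥(LinearMap.range (d (syzygyIndex k K - 1))),
        y = Matrix.det (Matrix.of fun i j => ((ι (g i) j : ↥T) : K)) *
          (Matrix.det (Matrix.of fun i j => ((ι (x i) j : ↥T) : K)))⁻¹}))) := by
    rw [← locAt_step_eq O O le_rfl T hk hT b d ε r ι x hε h0 hs hι htors hx0 hmin]
    exact (locAt_locAt O _ (nrm_toSubring_le O hk (chart_toSubring_le O hk hT))).symm
  -- the base change of `C` and its normalisation
  obtain ⟨ψC, hψC⟩ := exists_bcHom (k' := k') (Algebra.adjoin k ((T : Set K) ∪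
      {y : K | ∃ g : Fin r → ↥(LinearMap.range (d (syzygyIndex k K - 1))),
        y = Matrix.det (Matrix.of fun i j => ((ι (g i) j : ↥T) : K)) *
          (Matrix.det (Matrix.of fun i j => ((ι (x i) j : ↥T) : K)))⁻¹}))
  obtain ⟨XC, hXC⟩ := exists_bcX hrange (Algebra.adjoin k ((T : Set K) ∪
      {y : K | ∃ g : Fin r → ↥(LinearMap.range (d (syzygyIndex k K - 1))),
        y = Matrix.det (Matrix.of fun i j => ((ι (g i) j : ↥T) : K)) *
          (Matrix.det (Matrix.of fun i j => ((ι (x i) j : ↥T) : K)))⁻¹}))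
  have hlocC := stub_baseChange_isLocalization k K k' hrange _ _ rfl ψC XC hψC hXC
  have hnrm := stub_nrm_baseChange k K k' hrange _ _ rfl hFracC ψC XC hψC hXC hlocC
  have hEC := bc_adjoin_eq (k := k) (k' := k') ((T : Set K) ∪
      {y : K | ∃ g : Fin r → ↥(LinearMap.range (d (syzygyIndex k K - 1))),
        y = Matrix.det (Matrix.of fun i j => ((ι (g i) j : ↥T) : K)) *
          (Matrix.det (Matrix.of fun i j => ((ι (x i) j : ↥T) : K)))⁻¹})
  -- the k'-side step in canonical form
  have hLO' : (locAt O' E).toSubring ≤ O'.toSubring := locAt_le O' E hET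
  have hR₂O' : {y : RatFunc K | ∃ g : Fin r₂ → ↥(LinearMap.range (d₂
      (syzygyIndex k' (RatFunc K) - 1))),
        y = Matrix.det (Matrix.of fun i j => ((ι₂ (g i) j : ↥(locAt O' E)) : RatFunc K)) *
          (Matrix.det (Matrix.of fun i j => ((ι₂ (x₂ i) j : ↥(locAt O' E)) : RatFunc K)))⁻¹} ⊆
      O' := by
    rintro _ ⟨g, rfl⟩
    exact hmin₂ g
  have hR₁O' : {y : RatFunc K | ∃ g : Fin r₁ → ↥(LinearMap.range (d₁
      (syzygyIndex k' (RatFunc K) - 1))),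
        y = Matrix.det (Matrix.of fun i j => ((ι₁ (g i) j : ↥E) : RatFunc K)) *
          (Matrix.det (Matrix.of fun i j => ((ι₁ (x₁ i) j : ↥E) : RatFunc K)))⁻¹} ⊆ O' := by
    rintro _ ⟨g, rfl⟩
    exact hmin₁ g
  have hadjLO' := adjoin_ratios_le O' O' le_rfl (locAt O' E) hk' hLO' _ hR₂O'
  have hadjEO' := adjoin_ratios_le O' O' le_rfl E hk' hET _ hR₁O'
  have hL' := locAt_step_eq O' O' le_rfl (locAt O' E) hk' hLO' b₂ d₂ ε₂ r₂ ι₂ x₂ hε₂ h0₂ hs₂ hι₂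
    htors₂ hx0₂ hmin₂
  have hfix' : locAt O' (step O' (locAt O' E)) = step O' (locAt O' E) :=
    locAt_locAt O' _ (nrm_toSubring_le O' hk' (chart_toSubring_le O' hk' hLO'))
  -- assemble
  rw [← hfix', hL', ← stub_nrm_locAt k' (RatFunc K) O' _ hk' hadjLO', hadj₂,
    stub_nrm_locAt k' (RatFunc K) O' _ hk' hadjEO', hadj₁, ← hEC, hnrm, hL,
    locAt_bc_locAt O O' hOO' hk' _ hnrmCO]

/-- **The tower commutes with the base change `(k, K) ↦ (k(X), K(X))`**: stage by stage,
`tower O' (k'·A) m = locAt O' (k'·(tower O A m))`. [cite: Matsumura1987, §19 (after Lemma 4)] -/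
theorem tower_baseChange
    (hrange : Set.range (algebraMap k' (RatFunc K)) =
      ((IntermediateField.adjoin k {(RatFunc.X : RatFunc K)} : IntermediateField k (RatFunc K)) :
        Set (RatFunc K)))
    (O : ValuationSubring K) (O' : ValuationSubring (RatFunc K))
    (hOO' : ∀ x : K, x ∈ O → algebraMap K (RatFunc K) x ∈ O')
    (hk : ∀ c : k, algebraMap k K c ∈ O) (hk' : ∀ g : k', algebraMap k' (RatFunc K) g ∈ O')
    (hidx : syzygyIndex k' (RatFunc K) = syzygyIndex k K)
    (A : Subalgebra k K) (hFG : A.FG) (hFrac : IsFractionRing ↥A K)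
    (hAO : A.toSubring ≤ O.toSubring) :
    ∀ m : ℕ, tower O' (Algebra.adjoin k' ((algebraMap K (RatFunc K)) '' (A : Set K))) m =
      locAt O' (Algebra.adjoin k' ((algebraMap K (RatFunc K)) '' (tower O A m : Set K))) := by
  intro m
  induction m with
  | zero =>
    rw [tower_zero, tower_zero, locAt_bc_locAt O O' hOO' hk' A hAO]
  | succ m ih =>
    rw [tower_succ', tower_succ', ih]
    exact step_baseChange hrange O O' hOO' hk hk' hidx (tower O A m) (tower_toSubring_le O hk hAO m)
      (isFractionRing_tower O A hFrac m) (essFiniteType_tower O A hk hFG hFrac hAO m)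

/-- **Termination descends along the base change**: if `O = O' ∩ K` (so that the stages map by
flat LOCAL homomorphisms) and the tower along `O'` started at `k'·A` reaches a regular local ring,
so does the tower along `O` started at `A` (`tower_baseChange` + `stub_regularity_descends`).
[cite: Matsumura1987, Thm. 23.7 (i)] -/
theorem towerTerminates_of_baseChange
    (hrange : Set.range (algebraMap k' (RatFunc K)) =
      ((IntermediateField.adjoin k {(RatFunc.X : RatFunc K)} : IntermediateField k (RatFunc K)) :
        Set (RatFunc K)))
    (O : ValuationSubring K) (O' : ValuationSubring (RatFunc K))
    (hcomap : ∀ x : K, x ∈ O ↔ algebraMap K (RatFunc K) x ∈ O')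
    (hk : ∀ c : k, algebraMap k K c ∈ O) (hk' : ∀ g : k', algebraMap k' (RatFunc K) g ∈ O')
    (hidx : syzygyIndex k' (RatFunc K) = syzygyIndex k K)
    (A : Subalgebra k K) (hFG : A.FG) (hFrac : IsFractionRing ↥A K)
    (hAO : A.toSubring ≤ O.toSubring)
    (hterm : TowerTerminates O' (Algebra.adjoin k' ((algebraMap K (RatFunc K)) '' (A : Set K)))) :
    TowerTerminates O A := by
  have hOO' : ∀ x : K, x ∈ O → algebraMap K (RatFunc K) x ∈ O' := fun x hx => (hcomap x).mp hx
  obtain ⟨m, hreg⟩ := hterm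
  refine ⟨m, ?_⟩
  rw [tower_baseChange hrange O O' hOO' hk hk' hidx A hFG hFrac hAO m] at hreg
  set T := tower O A m with hTdef
  have hT : T.toSubring ≤ O.toSubring := tower_toSubring_le O hk hAO m
  haveI hEFT : Algebra.EssFiniteType k ↥T := essFiniteType_tower O A hk hFG hFrac hAO m
  have hNoeth : IsNoetherianRing ↥T := Algebra.EssFiniteType.isNoetherianRing k ↥T
  obtain ⟨ψ, hψ⟩ := exists_bcHom (k' := k') T
  obtain ⟨XE, hXE⟩ := exists_bcX hrange T
  have hloc := stub_baseChange_isLocalization k K k' hrange T _ rfl ψ XE hψ hXE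
  exact stub_regularity_descends k K O O' k' hrange hcomap hk' T _ rfl hT (locAt_tower O A hk hAO m)
    hNoeth ψ XE hψ hXE hloc hreg

end tower

end Summit.ResolutionOfSingularities.ResolutionOfSingularities.Theorems.SyzygyFlattening

end
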